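import Summits.Schanuel.Schanuel.Theorems.RoyCriterionNguyenRoySmallValueTranslatesStubConcentratedClosesLemmas
import HarnessLib

/-!
# Route `RoyCriterion`, crux `NguyenRoySmallValueTranslates` (stmt-Schanuel-1051), line `Sketch`
# — stub `stub_concentratedCloses`

Registered stub A of the skeleton of line `Sketch` for the crux
`Summit.Schanuel.Schanuel.Theses.RoyCriterion.NguyenRoySmallValueTranslates`: over an abstract
`NguyenRoy.EndgameData σ β ν` (the data entering §6 of Nguyen–Roy 2016) with `1 ≤ σ`,
`β > σ + 1`, `ν > 2 + β − σ`, it is absurd that at arbitrarily large levels `D` ONE point `a₀` of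
`Z_D` carries half of Corollary 16's bound,
`D^β + log dist(a₀, γ_{ι(a₀)}) ≤ −(κ/2) D^{ν−β+σ−2} (2D^β deg Z_D + D h(Z_D))`.

Proof (the argument of §6, Case 2, run for the recentred class): along the concentrated levels,
recentre `Z' := τ^{−ι(a₀)} Z_D`, so that `a₀' := τ^{−ι(a₀)} a₀ ∈ Z'` is within `exp(−D)` of `γ₀`
(Lemma 5, `recentre_bounds`); hence `max(deg Z', h(Z'))` diverges along these levels
(`EndgameData.eventually_lt_card_or_lt_ht`), so the auxiliary level `d` of (6.1) for `Z'` is large,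
and it is `< D` (`bounds_self`), with the (6.3)-type bounds; the polynomial argument at the level
`d` is `concCase_core` (helper file `…StubConcentratedClosesLemmas.lean`).

## References

* [NguyenRoy2016] N. A. V. Nguyen, D. Roy, IJNT 12 (2016) 1273–1293 = arXiv:1412.5163, §6
  (Case 2, (6.1)–(6.6)), Proposition 14, Proposition 17, Lemmas 5 and 11.
-/

-- `Summit.Schanuel.Schanuel.…` is the mandated layout of this single-problem summit (CONVENTIONS §1).
set_option linter.dupNamespace false

noncomputable section

open Filter Finset
open scoped Classical

namespace Summit.Schanuel.Schanuel.Theorems.NguyenRoySharp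

open Literature.NumberTheory.Transcendental
open Literature.NumberTheory.Transcendental.NguyenRoy

section Abstract

variable {σ β ν : ℝ} (E : EndgameData σ β ν)

/-- **Stub A — the concentrated case closes at the Dirichlet edge.** If at arbitrarily large levels
`D` one point `a₀` of `Z_D` alone carries half of Corollary 16's bound (for some admissible index
function `ι`, `0 ≤ ι < ⌊D^σ⌋`), contradiction — for every `1 ≤ σ`, `β > σ+1`, `ν > 2+β−σ`.
Proof: recentre at `m := ι a₀` (`recentre_bounds`), extract the concentrated levels as a
subsequence along which `max(deg, h)` of the recentred class diverges
(`eventually_lt_card_or_lt_ht`), take the auxiliary level `d` of (6.1) for the recentred class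
(`bounds_self` ⇒ `d < D`; (6.3) by maximality) and run `concCase_core`.
[cite: NguyenRoy2016, §6, Case 2 and Proposition 17] -/
theorem stub_concentratedCloses (hσ1 : 1 ≤ σ) (hβ : σ + 1 < β) (hν : 2 + β - σ < ν)
    (hconc : ∃ᶠ D : ℕ in atTop, ∃ ι : E.Pt → ℤ,
      (∀ a ∈ E.pts (E.Z D), 0 ≤ ι a ∧ ι a < (⌊(D : ℝ) ^ σ⌋₊ : ℕ)) ∧
      ∃ a₀ ∈ E.pts (E.Z D),
        (D : ℝ) ^ β + Real.log (E.dist a₀ (E.γ (ι a₀))) ≤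
          -(E.κ / 2 * (D : ℝ) ^ (ν - β + σ - 2) *
            (2 * (D : ℝ) ^ β * (E.pts (E.Z D)).card + D * E.ht (E.Z D)))) :
    False := by
  have hκ := E.κ_pos
  have hA0 : 0 < E.A₁₄ := by linarith [E.one_le_A₁₄]
  have hB0 : 0 < E.B₁₄ := by linarith [E.one_le_B₁₄]
  -- the concentrated levels `D ≥ max D₀ 1` with `(c₁ + 1) D^σ ≤ D^β`, as a subsequence `φ`
  have ev1 : ∀ᶠ D : ℕ in atTop, (E.c₁ + 1) * (D : ℝ) ^ σ ≤ (D : ℝ) ^ β :=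
    EndgameData.eventually_mul_rpow_le_rpow _ (by linarith)
  obtain ⟨φ, hφ, hP⟩ := extraction_of_frequently_atTop
    ((ev1.and (eventually_ge_atTop (max E.D₀ 1))).and_frequently hconc)
  choose hthr ι hι a₀ ha₀ hle using hP
  -- the recentring shifts `m n = ι(a₀)` at the level `φ n`
  obtain ⟨m, hm⟩ : ∃ m : ℕ → ℕ, ∀ n, ((m n : ℕ) : ℤ) = ι n (a₀ n) :=
    ⟨fun n => (ι n (a₀ n)).toNat, fun n => Int.toNat_of_nonneg (hι n _ (ha₀ n)).1⟩
  have hmT : ∀ n, m n < ⌊((φ n : ℕ) : ℝ) ^ σ⌋₊ := fun n => by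
    have h := (hι n _ (ha₀ n)).2
    rw [← hm n] at h
    exact_mod_cast h
  have hD0 : ∀ n, E.D₀ ≤ φ n := fun n => le_trans (le_max_left _ _) (hthr n).2
  have hD1 : ∀ n, 1 ≤ φ n := fun n => le_trans (le_max_right _ _) (hthr n).2
  have hrec : ∀ n, Real.log (E.dist (E.τ (-(m n : ℤ)) (a₀ n)) (E.γ 0)) ≤
      E.c₁ * (φ n : ℝ) ^ σ - (φ n : ℝ) ^ β -
        E.κ / 2 * (φ n : ℝ) ^ (ν - β + σ - 2) *
          (2 * (φ n : ℝ) ^ β * (E.pts (E.Z (φ n))).card + (φ n) * E.ht (E.Z (φ n))) ∧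
      E.ht (E.τV (-(m n : ℤ)) (E.Z (φ n))) ≤
        E.ht (E.Z (φ n)) + E.c₄ * (φ n : ℝ) ^ σ * (E.pts (E.Z (φ n))).card := fun n => by
    have h := hle n
    rw [← hm n] at h
    exact recentre_bounds E (hmT n) (ha₀ n) h
  -- `max(deg, h)` of the recentred classes diverges
  have hdiv : ∀ Bd : ℝ, ∀ᶠ n : ℕ in atTop,
      Bd < (E.pts (E.τV (-(m n : ℤ)) (E.Z (φ n)))).card ∨
        Bd < E.ht (E.τV (-(m n : ℤ)) (E.Z (φ n))) := by
    intro Bd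
    refine E.eventually_lt_card_or_lt_ht (fun n => E.τV (-(m n : ℤ)) (E.Z (φ n)))
      (ε := fun n => Real.exp (-((φ n : ℕ) : ℝ))) ?_ ?_ Bd
    · exact Real.tendsto_exp_neg_atTop_nhds_zero.comp
        (tendsto_natCast_atTop_atTop.comp hφ.tendsto_atTop)
    · refine Filter.Eventually.of_forall fun n => ⟨_, E.τ_mem_pts_τV _ _ (ha₀ n), ?_⟩
      show E.dist (E.τ (-(m n : ℤ)) (a₀ n)) (E.γ 0) ≤ Real.exp (-((φ n : ℕ) : ℝ))
      have hpos : 0 < E.dist (E.τ (-(m n : ℤ)) (a₀ n)) (E.γ 0) :=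
        E.dist_γ_pos _ _ (E.τ_mem_pts_τV _ _ (ha₀ n)) 0
      rw [← Real.log_le_iff_le_exp hpos]
      have h1 := (hrec n).1
      have hDr : (1 : ℝ) ≤ φ n := by exact_mod_cast hD1 n
      have hDσ : (φ n : ℝ) ≤ (φ n : ℝ) ^ σ := by
        calc (φ n : ℝ) = (φ n : ℝ) ^ (1 : ℝ) := (Real.rpow_one _).symm
          _ ≤ (φ n : ℝ) ^ σ := Real.rpow_le_rpow_of_exponent_le hDr hσ1
      have hnn : 0 ≤ E.κ / 2 * (φ n : ℝ) ^ (ν - β + σ - 2) *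
          (2 * (φ n : ℝ) ^ β * (E.pts (E.Z (φ n))).card + (φ n) * E.ht (E.Z (φ n))) := by
        have := E.ht_nonneg (E.Z (φ n)); positivity
      linarith [(hthr n).1]
  -- thresholds
  obtain ⟨N₂, hN₂⟩ := Filter.eventually_atTop.mp (EndgameData.case2i_eventually (A := E.A₁₄)
    (B := E.B₁₄) (ν := ν) E.c₇_nonneg E.c₄_nonneg hσ1 hβ hν)
  obtain ⟨N₄, hN₄⟩ := Filter.eventually_atTop.mp
    (EndgameData.coeff_eventually (c₁ := E.c₁) hσ1 hβ)
  obtain ⟨N₆, hN₆⟩ := Filter.eventually_atTop.mp (concCase_eventually (c₁ := E.c₁)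
    (c₇ := E.c₇) (c₄ := E.c₄) E.κ_pos hσ1 hβ hν)
  set N₅ : ℕ := ⌈(1 + β - σ) / Real.log 2⌉₊ with hN₅
  set N₀ : ℕ := E.D₀ + 1 + N₂ + N₄ + N₅ + N₆ with hN₀
  obtain ⟨n₀, hn₀⟩ := Filter.eventually_atTop.mp
    (hdiv (max (E.A₁₄ * (N₀ : ℝ) ^ (2 - σ)) (E.B₁₄ * (N₀ : ℝ) ^ (1 + β - σ))))
  -- the level `D = φ n`
  obtain ⟨n, hn₀n, hN₀n⟩ : ∃ n, n₀ ≤ n ∧ N₀ ≤ n :=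
    ⟨n₀ + N₀, Nat.le_add_right _ _, Nat.le_add_left _ _⟩
  have hnD : n ≤ φ n := hφ.le_apply
  obtain ⟨hclose, hhtZ⟩ := hrec n
  have hcardn : (E.pts (E.τV (-(m n : ℤ)) (E.Z (φ n)))).card = (E.pts (E.Z (φ n))).card :=
    E.card_pts_τV _ _
  rw [← hcardn] at hclose hhtZ
  have hself := E.bounds_self (hD0 n) (hmT n)
  have hcritN := hn₀ n hn₀n
  have ha₀' : E.τ (-(m n : ℤ)) (a₀ n) ∈ E.pts (E.τV (-(m n : ℤ)) (E.Z (φ n))) :=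
    E.τ_mem_pts_τV _ _ (ha₀ n)
  set Zt : E.V := E.τV (-(m n : ℤ)) (E.Z (φ n)) with hZt
  set D : ℕ := φ n with hD
  have hN₀D : N₀ ≤ D := le_trans hN₀n hnD
  -- (6.1) for the recentred class and its auxiliary level `d`
  obtain ⟨Q, hQ⟩ : ∃ Q : ℕ → Prop, ∀ k, Q k ↔ (E.A₁₄ * (k : ℝ) ^ (2 - σ) < (E.pts Zt).card ∨
      E.B₁₄ * (k : ℝ) ^ (1 + β - σ) < E.ht Zt) := ⟨_, fun k => Iff.rfl⟩
  have hQN₀ : Q N₀ := by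
    rw [hQ]
    rcases hcritN with h | h
    · exact Or.inl (lt_of_le_of_lt (le_max_left _ _) h)
    · exact Or.inr (lt_of_le_of_lt (le_max_right _ _) h)
  obtain ⟨d, hN₀d, hdD, hQd, hmax⟩ : ∃ d : ℕ, N₀ ≤ d ∧ d ≤ D ∧ Q d ∧
      ∀ k, d < k → k ≤ D → ¬ Q k :=
    ⟨Nat.findGreatest Q D, Nat.le_findGreatest hN₀D hQN₀, Nat.findGreatest_le _,
      Nat.findGreatest_spec hN₀D hQN₀, fun k hk hkD => Nat.findGreatest_is_greatest hk hkD⟩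
  have hcrit := (hQ d).mp hQd
  have hdD' : d < D := by
    rcases hdD.lt_or_eq with h | h
    · exact h
    · exfalso
      rw [h] at hcrit
      rcases hcrit with hc | hc <;> linarith [hself.1, hself.2]
  -- the (6.3)-type bounds
  have h4 := hmax (d + 1) (Nat.lt_succ_self d) hdD'
  rw [hQ] at h4
  push_cast at h4
  push Not at h4
  have hd1 : 1 ≤ d := le_trans (by omega) hN₀d
  have hd1r : (1 : ℝ) ≤ d := by exact_mod_cast hd1
  have hlog2 : 0 < Real.log 2 := Real.log_pos (by norm_num)
  have hdN₅ : (1 + β - σ) / Real.log 2 ≤ (d : ℝ) :=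
    le_trans (Nat.le_ceil _) (by exact_mod_cast (show N₅ ≤ d by omega))
  have e1 : ((d : ℝ) + 1) ^ (2 - σ) ≤ 2 * (d : ℝ) ^ (2 - σ) := by
    rcases le_or_gt 0 (2 - σ) with h2σ | h2σ
    · exact EndgameData.add_one_rpow_le_two_mul_rpow h2σ hd1r
        (le_trans (div_le_div_of_nonneg_right (by linarith) hlog2.le) hdN₅)
    · have i1 : ((d : ℝ) + 1) ^ (2 - σ) ≤ (d : ℝ) ^ (2 - σ) :=
        Real.rpow_le_rpow_of_nonpos (by positivity) (by linarith) h2σ.le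
      have i2 : 0 ≤ (d : ℝ) ^ (2 - σ) := by positivity
      linarith
  have e2 : ((d : ℝ) + 1) ^ (1 + β - σ) ≤ 2 * (d : ℝ) ^ (1 + β - σ) :=
    EndgameData.add_one_rpow_le_two_mul_rpow (by linarith) hd1r hdN₅
  have hdeg : ((E.pts Zt).card : ℝ) ≤ 2 * E.A₁₄ * (d : ℝ) ^ (2 - σ) := by
    calc ((E.pts Zt).card : ℝ) ≤ E.A₁₄ * ((d : ℝ) + 1) ^ (2 - σ) := h4.1
      _ ≤ E.A₁₄ * (2 * (d : ℝ) ^ (2 - σ)) := mul_le_mul_of_nonneg_left e1 hA0.le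
      _ = 2 * E.A₁₄ * (d : ℝ) ^ (2 - σ) := by ring
  have hht : E.ht Zt ≤ 2 * E.B₁₄ * (d : ℝ) ^ (1 + β - σ) := by
    calc E.ht Zt ≤ E.B₁₄ * ((d : ℝ) + 1) ^ (1 + β - σ) := h4.2
      _ ≤ E.B₁₄ * (2 * (d : ℝ) ^ (1 + β - σ)) := mul_le_mul_of_nonneg_left e2 hB0.le
      _ = 2 * E.B₁₄ * (d : ℝ) ^ (1 + β - σ) := by ring
  -- conclude by the core at the level `D`, auxiliary level `d`
  have hN₆D : N₆ ≤ D := by omega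
  exact concCase_core E hσ1 hβ hd1 hdD (by omega) (hN₂ d (by omega)) (hN₄ d (by omega))
    (hN₆ D hN₆D).1 (hN₆ D hN₆D).2 hcrit hdeg hht (E.ht_nonneg _) hhtZ ha₀' hclose

end Abstract

end Summit.Schanuel.Schanuel.Theorems.NguyenRoySharp

end
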